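import Literature.AnabelianGeometry.EtaleTheta.Discharge.Sec2Cor219iiiLevelCompat
import HarnessLib

/-!
# [EtTh] Cor. 2.19 (iii), tower form — (b2) LEVEL COMPATIBILITY of the level-wise Δ_P-hearts (roadmap M2), GENERIC, part 2:
# exponents from hearts at one point, the square variant, and (b2) ASSEMBLED at every pair with odd lower level (proof-only)

S. Mochizuki, *The étale theta function and its Frobenioid-theoretic manifestations*, Publ. RIMS **45** (2009) [EtTh],
§2, Cor. 2.19 (iii), PRIMS PDF p. 65 («by taking a compatible system of members of the above collections of classes»,
l. 36 of p. 65 in the PRIMS render); Cor. 2.19 (i),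
p. 64 (the étale theta class identifies `Δ_Θ` with the coefficients — `rootCocycle_apply`) [cite: MochizukiEtTh2009, Cor 2.19(iii) p.65].

Cell `abc-iut`, seat abc-iut-f-142 (gen 6), K-L6 row «COR219III-M1b», slice (b2) = roadmap M2; sequel of part 1
(`Sec2Cor219iiiLevelCompat`: quadratic law, odd-level vanishing, `red_conjRoot_zpow_eq_of_modEq`).  PROOF-ONLY: no definition,
no instance, no notation, no new named fact; GENERIC over every §1 setting, `X̲̲`-choice and tower; this lineage's
`Sec2Cor219iiiHeartPrelims` (`conjRoot_pow_coe_eq`, `toTheta_conj_zpow_comm`) and part 1 consumed BY NAME, nothing restated.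

WHAT IS SHOWN.
* §2b SQUARE VARIANT of the vanishing, ANY parity: if `e = θ[σ⁻¹; c₁]` is a square `s²` in `l·Δ_Θ` then `red_M f(c_M) = 1` and
  `red_M ∘ conjRoot (σ^M) f = red_M ∘ f` at that point for EVERY `M` (`red_apply_pow_comm_eq_one_of_sq`, `red_conjRoot_pow_eq_of_sq`)
  — the form usable at data where geometric commutators are squares (the Tate model, p487040), for the even-level row (β).
* §3 EXPONENTS FROM HEARTS: the split `conjRoot (a^m) f (b) = θ⁅a⁻¹,b⁆^m · f(b)` inside `l·Δ_Θ` (`conjRoot_zpow_eq_comm_zpow_mul`);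
  two level-`M` hearts AT THE SINGLE POINT `b` with exponents `m, m′`, plus «`red_M θ⁅a⁻¹,b⁆` generates `μ_M`» (the `hgen` shape
  of `heart_of_dense_of_zpowers`, p477834), force `m ≡ m′ (mod M)` (`zmodEq_of_red_conjRoot_zpow_eq`; `orderOf = |μ_M| = M`).
* §4 **(b2) ASSEMBLED** (`levelCompat_of_hearts`): for ANY exponent family `m : E → ℤ` whose level-wise hearts hold at `b`
  (against one value `v`, e.g. `v = F(b)` for the transport `F = Φ_γ f`), and any pair `M ∣ M′` whose LOWER level `M` is odd
  with `hgen` at `M`: `red_M conjRoot (a^{m M′}) f (g) = red_M conjRoot (a^{m M}) f (g)` for EVERY `g ∈ Π^tp_Ÿ̲̲` — the clause (b2)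
  of abc-iut-C-hgal-2's `cor219_iii_of_hearts` (p482618) for `x M := a^{m M}` at that pair: the heart at `M′`, pushed down by
  `τ.red_mod`, is a second level-`M` heart, so §3 then part 1's `red_conjRoot_zpow_eq_of_modEq`.  NOT CLAIMED: pairs with EVEN
  lower level (`hgen` fails there at the Tate model, p487040 `not_hgen_thetaEnvTower_of_two_dvd`; row «COR219III-M1b-EVEN
  (β)»); by part 1 §0 every tower has such levels.
* §5 (v2, append-only) GLUE `exists_exponent_value_of_residue` / `forall_exists_exponent_value_of_residue`: the RESIDUE form
  «`red_M θ⁅(a^m)⁻¹,b⁆ = red_M v·(red_M f b̃)⁻¹`» of a point-heart (abc-iut-w5-d187, p492447) ⇒ the VALUE form «`red_M v =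
  red_M (conjRoot (a^m) f b̃)`» consumed by the compatible-exponent choice and the level-dependent knit (p493568).

HONEST FRAMING: unconditional statements about OUR typed objects over an arbitrary §1 setting; nothing of [EtTh]
(refereed) is asserted beyond what is proved; no side is taken on [IUTchIII] Cor. 3.12 or on any author; typed ≠ proved;
nothing here asserts abc proved or refuted.
-/

noncomputable section

namespace Literature.AnabelianGeometry.EtaleTheta

open Literature.AnabelianGeometry.SemiGraphs
open scoped IsMulCommutative

namespace ThetaSetting.EtaleThetaData.DoubleUnderline

variable {p : ℕ} [Fact p.Prime] {D : ThetaSetting p} {E : D.EtaleThetaData} {l : ℕ}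
  (C : E.DoubleUnderline l) {Es : Set ℕ+} (τ : D.CyclotomeTower l Es)

/-! ## §2b. The square variant of the vanishing (any parity) -/

/-- **Square variant of the vanishing, ANY parity.**  If `e = θ[σ⁻¹;c₁]` is a SQUARE `s²` with `s ∈ l·Δ_Θ`, then for EVERY
`M ∈ E`: `red_M (f(c_M)) = 1` — `f(c_M) = s^{M(M−1)} f(c₁)^M = (s^{M−1} f(c₁))^M`.  (At data where geometric commutators are squares —
e.g. the Tate model, p487040 — this removes the parity condition from §2; the even-level row (β) may consume it BY NAME.)
[cite: MochizukiEtTh2009, Cor 2.19(iii) p.65] -/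
theorem red_apply_pow_comm_eq_one_of_sq (hC : D.Compat) (h15 : Prop15iii E hC)
    {f : contCocycles D.toTheta D.DeltaTheta C.GtpYdduu} (hf : f ∈ C.rootCocycles hC)
    (σ : C.Huu) (hσ : D.aug.toMonoidHom (σ : D.PiTemp) = 1) (k : C.GtpYdduu) (M : Es)
    (s : D.lDeltaTheta l) (hsq : (s : D.GtpTheta) ^ 2 =
      D.toTheta ((σ : D.PiTemp)⁻¹ * ((σ : D.PiTemp)⁻¹ * k * σ * (k : D.PiTemp)⁻¹) * σ *
        ((σ : D.PiTemp)⁻¹ * k * σ * (k : D.PiTemp)⁻¹)⁻¹)) :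
    (τ.mod M).red ⟨(f.1 ⟨_, C.conj_mul_inv_mem_GtpYdduu hC (σ ^ ((M : ℕ+) : ℕ)) k⟩ : D.GtpTheta), hf.1 _⟩ = 1 := by
  have hch : 2 * ((M : ℕ+) : ℕ).choose 2 = ((M : ℕ+) : ℕ) * (((M : ℕ+) : ℕ) - 1) := by
    rw [Nat.choose_two_right, Nat.two_mul_div_two_of_even (Nat.even_mul_pred_self _)]
  have hcomm : Commute (s : D.GtpTheta) (f.1 ⟨_, C.conj_mul_inv_mem_GtpYdduu hC σ k⟩ : D.GtpTheta) :=
    D.ker_thetaToEll_comm _ (D.lDeltaTheta_le l s.2) _ (f.1 _).2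
  have hval : (f.1 ⟨_, C.conj_mul_inv_mem_GtpYdduu hC (σ ^ ((M : ℕ+) : ℕ)) k⟩ : D.GtpTheta) =
      ((s : D.GtpTheta) ^ (((M : ℕ+) : ℕ) - 1) * (f.1 ⟨_, C.conj_mul_inv_mem_GtpYdduu hC σ k⟩ : D.GtpTheta)) ^
        ((M : ℕ+) : ℕ) := by
    rw [C.coe_apply_pow_comm hC h15 hf σ hσ k, ← hsq, ← pow_mul, hch, mul_comm, pow_mul,
      (hcomm.pow_left _).mul_pow]
  have hpow : (⟨(s : D.GtpTheta) ^ (((M : ℕ+) : ℕ) - 1) * (f.1 ⟨_, C.conj_mul_inv_mem_GtpYdduu hC σ k⟩ : D.GtpTheta),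
        (D.lDeltaTheta l).mul_mem ((D.lDeltaTheta l).pow_mem s.2 _) (hf.1 _)⟩ : D.lDeltaTheta l) ^ ((M : ℕ+) : ℕ) =
      ⟨(f.1 ⟨_, C.conj_mul_inv_mem_GtpYdduu hC (σ ^ ((M : ℕ+) : ℕ)) k⟩ : D.GtpTheta), hf.1 _⟩ :=
    Subtype.ext (by rw [Subgroup.coe_pow]; exact hval.symm)
  rw [← hpow, map_pow]
  have hcard := pow_card_eq_one (G := MuN p (M : ℕ+))
    (x := (τ.mod M).red ⟨(s : D.GtpTheta) ^ (((M : ℕ+) : ℕ) - 1) * (f.1 ⟨_, C.conj_mul_inv_mem_GtpYdduu hC σ k⟩ : D.GtpTheta),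
        (D.lDeltaTheta l).mul_mem ((D.lDeltaTheta l).pow_mem s.2 _) (hf.1 _)⟩)
  rwa [card_MuN] at hcard

/-- **`red_M ∘ conjRoot (σ^M) f = red_M ∘ f` at the point `k`, ANY parity, when `θ[σ⁻¹; σ⁻¹kσk⁻¹]` is a square in `l·Δ_Θ`.**
[cite: MochizukiEtTh2009, Cor 2.19(iii) p.65] -/
theorem red_conjRoot_pow_eq_of_sq (hC : D.Compat) (h15 : Prop15iii E hC)
    {f : contCocycles D.toTheta D.DeltaTheta C.GtpYdduu} (hf : f ∈ C.rootCocycles hC)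
    (σ : C.Huu) (hσ : D.aug.toMonoidHom (σ : D.PiTemp) = 1) (k : C.GtpYdduu) (M : Es)
    (s : D.lDeltaTheta l) (hsq : (s : D.GtpTheta) ^ 2 =
      D.toTheta ((σ : D.PiTemp)⁻¹ * ((σ : D.PiTemp)⁻¹ * k * σ * (k : D.PiTemp)⁻¹) * σ *
        ((σ : D.PiTemp)⁻¹ * k * σ * (k : D.PiTemp)⁻¹)⁻¹)) :
    (τ.mod M).red ⟨(C.conjRoot hC (σ ^ ((M : ℕ+) : ℕ)) f.1 k : D.GtpTheta),
        (D.lDeltaTheta_normal l).conj_mem _ (hf.1 _) _⟩ =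
      (τ.mod M).red ⟨(f.1 k : D.GtpTheta), hf.1 _⟩ := by
  have hσM : D.aug.toMonoidHom ((σ ^ ((M : ℕ+) : ℕ) : C.Huu) : D.PiTemp) = 1 := by
    rw [Subgroup.coe_pow, map_pow, hσ, one_pow]
  have hsplit : (⟨(C.conjRoot hC (σ ^ ((M : ℕ+) : ℕ)) f.1 k : D.GtpTheta),
      (D.lDeltaTheta_normal l).conj_mem _ (hf.1 _) _⟩ : D.lDeltaTheta l) =
      ⟨(f.1 ⟨_, C.conj_mul_inv_mem_GtpYdduu hC (σ ^ ((M : ℕ+) : ℕ)) k⟩ : D.GtpTheta), hf.1 _⟩ *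
        ⟨(f.1 k : D.GtpTheta), hf.1 _⟩ := by
    apply Subtype.ext
    change ((C.conjRoot hC (σ ^ ((M : ℕ+) : ℕ)) f.1 k : D.DeltaTheta) : D.GtpTheta) =
      (f.1 ⟨_, C.conj_mul_inv_mem_GtpYdduu hC (σ ^ ((M : ℕ+) : ℕ)) k⟩ : D.GtpTheta) * (f.1 k : D.GtpTheta)
    rw [C.conjRoot_eq_apply_comm_mul hC f _ hσM k, Subgroup.coe_mul]
  rw [hsplit, map_mul (τ.mod M).red, C.red_apply_pow_comm_eq_one_of_sq τ hC h15 hf σ hσ k M s hsq, one_mul]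

/-! ## §3. Exponents from hearts at one point: `m ≡ m′ (mod M)` -/

/-- The split `conjRoot (a^m) f (b) = θ⁅a⁻¹,b⁆^m · f(b)` INSIDE `l·Δ_Θ` (as an identity of elements of `l·Δ_Θ`, ready for `red_M`):
V1 at the geometric point `b` (`conjRoot_pow_coe_eq`) and bilinearity `θ⁅a^{-m},b⁆ = θ⁅a⁻¹,b⁆^m` (`toTheta_conj_zpow_comm`).
[cite: MochizukiEtTh2009, Cor 2.19(iii) p.65] -/
theorem conjRoot_zpow_eq_comm_zpow_mul (hC : D.Compat) (hS : D.Sec2Hyps) (h15 : Prop15iii E hC)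
    {f : contCocycles D.toTheta D.DeltaTheta C.GtpYdduu} (hf : f ∈ C.rootCocycles hC)
    (a : C.Huu) (ha : D.aug.toMonoidHom (a : D.PiTemp) = 1)
    (b : (C.thetaEnvTower τ hC hS).PiYdd) (hb : D.aug.toMonoidHom ((b : C.Huu) : D.PiTemp) = 1)
    (h₁ : D.toTheta (((a : D.PiTemp))⁻¹ * ((b : C.Huu) : D.PiTemp) * (a : D.PiTemp) * (((b : C.Huu) : D.PiTemp))⁻¹) ∈
      D.lDeltaTheta l) (m : ℤ) :
    (⟨(C.conjRoot hC (a ^ m) f.1 (C.inclYdduu b) : D.GtpTheta), (D.lDeltaTheta_normal l).conj_mem _ (hf.1 _) _⟩ :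
      D.lDeltaTheta l) = ⟨_, h₁⟩ ^ m * ⟨(f.1 (C.inclYdduu b) : D.GtpTheta), hf.1 _⟩ := by
  apply Subtype.ext
  have h1 := C.conjRoot_pow_coe_eq hC h15 hf a ha m (C.inclYdduu b) hb
  have h2 : D.toTheta (((a ^ m : C.Huu) : D.PiTemp)⁻¹ * ((b : C.Huu) : D.PiTemp) * ((a ^ m : C.Huu) : D.PiTemp) *
      (((b : C.Huu) : D.PiTemp))⁻¹) =
      D.toTheta ((a : D.PiTemp)⁻¹ * ((b : C.Huu) : D.PiTemp) * (a : D.PiTemp) * (((b : C.Huu) : D.PiTemp))⁻¹) ^ m := by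
    rw [Subgroup.coe_zpow]; exact D.toTheta_conj_zpow_comm (a : D.PiTemp) _ ha hb m
  calc ((C.conjRoot hC (a ^ m) f.1 (C.inclYdduu b) : D.DeltaTheta) : D.GtpTheta)
      = D.toTheta (((a ^ m : C.Huu) : D.PiTemp)⁻¹ * ((b : C.Huu) : D.PiTemp) * ((a ^ m : C.Huu) : D.PiTemp) *
          (((b : C.Huu) : D.PiTemp))⁻¹) * (f.1 (C.inclYdduu b) : D.GtpTheta) := h1
    _ = D.toTheta ((a : D.PiTemp)⁻¹ * ((b : C.Huu) : D.PiTemp) * (a : D.PiTemp) * (((b : C.Huu) : D.PiTemp))⁻¹) ^ m *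
          (f.1 (C.inclYdduu b) : D.GtpTheta) := by rw [h2]
    _ = (((⟨_, h₁⟩ : D.lDeltaTheta l) ^ m * ⟨(f.1 (C.inclYdduu b) : D.GtpTheta), hf.1 _⟩ : D.lDeltaTheta l) :
          D.GtpTheta) := by
        rw [Subgroup.coe_mul, Subgroup.coe_zpow]

/-- **Two level-`M` hearts at the single point `b` force congruent exponents.**  If `red_M (conjRoot (a^m) f b) =
red_M (conjRoot (a^{m′}) f b)` (e.g. both equal `red_M (F b)` for the transport `F`), and `ζ := red_M θ⁅a⁻¹,b⁆` GENERATES `μ_M`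
(the `hgen` input of `heart_of_dense_of_zpowers`; then `orderOf ζ = |μ_M| = M`, `card_MuN`), then `m ≡ m′ (mod M)`:
by §3's split the hypothesis reads `ζ^m · red_M f(b) = ζ^{m′} · red_M f(b)`. [cite: MochizukiEtTh2009, Cor 2.19(iii) p.65] -/
theorem zmodEq_of_red_conjRoot_zpow_eq (hC : D.Compat) (hS : D.Sec2Hyps) (h15 : Prop15iii E hC)
    {f : contCocycles D.toTheta D.DeltaTheta C.GtpYdduu} (hf : f ∈ C.rootCocycles hC)
    (a : C.Huu) (ha : D.aug.toMonoidHom (a : D.PiTemp) = 1)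
    (b : (C.thetaEnvTower τ hC hS).PiYdd) (hb : D.aug.toMonoidHom ((b : C.Huu) : D.PiTemp) = 1) (M : Es)
    (h₁ : D.toTheta (((a : D.PiTemp))⁻¹ * ((b : C.Huu) : D.PiTemp) * (a : D.PiTemp) * (((b : C.Huu) : D.PiTemp))⁻¹) ∈
      D.lDeltaTheta l)
    (hgen : ∀ u : MuN p M, ∃ n : ℤ, ((τ.mod M).red ⟨_, h₁⟩) ^ n = u) {m m' : ℤ}
    (h : (τ.mod M).red ⟨(C.conjRoot hC (a ^ m) f.1 (C.inclYdduu b) : D.GtpTheta),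
        (D.lDeltaTheta_normal l).conj_mem _ (hf.1 _) _⟩ =
      (τ.mod M).red ⟨(C.conjRoot hC (a ^ m') f.1 (C.inclYdduu b) : D.GtpTheta),
        (D.lDeltaTheta_normal l).conj_mem _ (hf.1 _) _⟩) :
    m ≡ m' [ZMOD ((M : ℕ+) : ℕ)] := by
  rw [C.conjRoot_zpow_eq_comm_zpow_mul τ hC hS h15 hf a ha b hb h₁ m,
    C.conjRoot_zpow_eq_comm_zpow_mul τ hC hS h15 hf a ha b hb h₁ m', map_mul (τ.mod M).red, map_mul (τ.mod M).red,
    map_zpow (τ.mod M).red, map_zpow (τ.mod M).red] at h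
  have hz : ((τ.mod M).red ⟨_, h₁⟩) ^ m = ((τ.mod M).red ⟨_, h₁⟩) ^ m' := mul_right_cancel h
  have hord : orderOf ((τ.mod M).red ⟨_, h₁⟩) = ((M : ℕ+) : ℕ) := by
    rw [orderOf_eq_card_of_forall_mem_zpowers (fun u => Subgroup.mem_zpowers_iff.2 (hgen u)), Nat.card_eq_fintype_card,
      card_MuN]
  have := (zpow_eq_zpow_iff_modEq.1 hz)
  rwa [hord] at this

/-! ## §4. (b2) assembled: level compatibility from the level-wise hearts, at every pair with odd lower level -/

/-- **(b2) LEVEL COMPATIBILITY FROM THE HEARTS (roadmap M2), generic form.**  Over ANY §1 setting and tower: let `f` be a root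
cocycle, `a ∈ Π^tp_X̲̲` and `b ∈ Π^tp_Ÿ̲̲` geometric with `θ⁅a⁻¹,b⁆ ∈ l·Δ_Θ`, `v ∈ l·Δ_Θ` one value (for FILE 2: `v := F(b)`, `F = Φ_γ f`
the transport), and `m : E → ℤ` ANY family of exponents whose LEVEL-WISE HEARTS HOLD AT `b`: `red_M v = red_M (conjRoot (a^{m M}) f b)`
for every `M ∈ E` (the conclusion of `heart_of_dense_of_zpowers` at `g := b`).  Then for every pair `M ∣ M′` in `E` whose LOWER
level `M` is ODD and at which `red_M θ⁅a⁻¹,b⁆` generates `μ_M` (the `hgen` input at `M`), and EVERY `g ∈ Π^tp_Ÿ̲̲` (arithmetic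
included): `red_M (conjRoot (a^{m M′}) f g) = red_M (conjRoot (a^{m M}) f g)` — the clause (b2) of `cor219_iii_of_hearts` (p482618)
for `x M := a^{m M}` at that pair.  PROOF: the level-`M′` heart pushed down by `τ.red_mod` is a second level-`M` heart at `b`, so
`m M ≡ m M′ (mod M)` (§3), and congruent exponents agree at odd `M` on all of `Π^tp_Ÿ̲̲` (§2).  NOT CLAIMED: pairs with EVEN lower
level (there `hgen` fails at the Tate model, p487040; row «COR219III-M1b-EVEN (β)»); by §0 every tower has such levels.
[cite: MochizukiEtTh2009, Cor 2.19(iii) p.65] -/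
theorem levelCompat_of_hearts (hC : D.Compat) (hS : D.Sec2Hyps) (h15 : Prop15iii E hC)
    {f : contCocycles D.toTheta D.DeltaTheta C.GtpYdduu} (hf : f ∈ C.rootCocycles hC)
    (a : C.Huu) (ha : D.aug.toMonoidHom (a : D.PiTemp) = 1)
    (b : (C.thetaEnvTower τ hC hS).PiYdd) (hb : D.aug.toMonoidHom ((b : C.Huu) : D.PiTemp) = 1)
    (h₁ : D.toTheta (((a : D.PiTemp))⁻¹ * ((b : C.Huu) : D.PiTemp) * (a : D.PiTemp) * (((b : C.Huu) : D.PiTemp))⁻¹) ∈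
      D.lDeltaTheta l)
    (v : D.lDeltaTheta l) (m : Es → ℤ)
    (hheart : ∀ M : Es, (τ.mod M).red v =
      (τ.mod M).red ⟨(C.conjRoot hC (a ^ m M) f.1 (C.inclYdduu b) : D.GtpTheta),
        (D.lDeltaTheta_normal l).conj_mem _ (hf.1 _) _⟩)
    (M M' : Es) (hMM' : (M : ℕ+) ∣ M') (hodd : ¬ 2 ∣ ((M : ℕ+) : ℕ))
    (hgen : ∀ u : MuN p M, ∃ n : ℤ, ((τ.mod M).red ⟨_, h₁⟩) ^ n = u)
    (g : (C.thetaEnvTower τ hC hS).PiYdd) :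
    (τ.mod M).red ⟨(C.conjRoot hC (a ^ m M') f.1 (C.inclYdduu g) : D.GtpTheta),
        (D.lDeltaTheta_normal l).conj_mem _ (hf.1 _) _⟩ =
      (τ.mod M).red ⟨(C.conjRoot hC (a ^ m M) f.1 (C.inclYdduu g) : D.GtpTheta),
        (D.lDeltaTheta_normal l).conj_mem _ (hf.1 _) _⟩ := by
  -- the level-`M'` heart at `b`, reduced to level `M`
  have hM'red : (τ.mod M).red v =
      (τ.mod M).red ⟨(C.conjRoot hC (a ^ m M') f.1 (C.inclYdduu b) : D.GtpTheta),
        (D.lDeltaTheta_normal l).conj_mem _ (hf.1 _) _⟩ := by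
    have h := congrArg (MuN.red p (M : ℕ+) (M' : ℕ+) (pnat_dvd hMM')) (hheart M')
    rwa [τ.red_mod, τ.red_mod] at h
  have hmod : m M ≡ m M' [ZMOD ((M : ℕ+) : ℕ)] :=
    C.zmodEq_of_red_conjRoot_zpow_eq τ hC hS h15 hf a ha b hb M h₁ hgen ((hheart M).symm.trans hM'red)
  exact C.red_conjRoot_zpow_eq_of_modEq τ hC h15 hf a ha (C.inclYdduu g) M hodd hmod


/-! ## §5 (v2, append-only). GLUE: the residue form of a point-heart (abc-iut-w5-d187, p492447) ⇒ the value form consumed by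
## `exists_compatible_exponents` / `cor219_iii_of_pointHearts_of_sq_of_origin` (p493568) -/

/-- **Residue form ⇒ value form of a point-heart.**  If for some exponent `m` the commutator value `red_M θ⁅(a^m)⁻¹, b⁆` equals
the DISCREPANCY `red_M v · (red_M f(b̃))⁻¹` (the output shape of abc-iut-w5-d187's
`exists_zpow_red_comm_eq_discrepancy_of_aug_apply_eq_one`, p492447, with `v := F(b̃)`), then `red_M v = red_M (conjRoot (a^m) f b̃)`
(the `∃ m` input shape of `exists_compatible_exponents` and of the level-dependent knit, p493568): `conjRoot (a^m) f b̃ =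
θ⁅(a^m)⁻¹, b⁆ · f(b̃)` at the geometric point (`conjRoot_pow_coe_eq`). [cite: MochizukiEtTh2009, Cor 2.19(iii) p.65] -/
theorem exists_exponent_value_of_residue (hC : D.Compat) (hS : D.Sec2Hyps) (h15 : Prop15iii E hC)
    {f : contCocycles D.toTheta D.DeltaTheta C.GtpYdduu} (hf : f ∈ C.rootCocycles hC)
    (a : C.Huu) (ha : D.aug.toMonoidHom (a : D.PiTemp) = 1)
    (b : (C.thetaEnvTower τ hC hS).PiYdd) (hb : D.aug.toMonoidHom ((b : C.Huu) : D.PiTemp) = 1) (M : Es)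
    (v : D.lDeltaTheta l)
    (hres : ∃ (m : ℤ) (hm : D.toTheta ((((a ^ m : C.Huu) : D.PiTemp))⁻¹ * ((b : C.Huu) : D.PiTemp) *
        ((a ^ m : C.Huu) : D.PiTemp) * (((b : C.Huu) : D.PiTemp))⁻¹) ∈ D.lDeltaTheta l),
      (τ.mod M).red ⟨_, hm⟩ = (τ.mod M).red v * ((τ.mod M).red ⟨(f.1 (C.inclYdduu b) : D.GtpTheta), hf.1 _⟩)⁻¹) :
    ∃ m : ℤ, (τ.mod M).red v =
      (τ.mod M).red ⟨(C.conjRoot hC (a ^ m) f.1 (C.inclYdduu b) : D.GtpTheta), (D.lDeltaTheta_normal l).conj_mem _ (hf.1 _) _⟩ := by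
  obtain ⟨m, hm, hred⟩ := hres
  refine ⟨m, ?_⟩
  have hsplit : (⟨(C.conjRoot hC (a ^ m) f.1 (C.inclYdduu b) : D.GtpTheta), (D.lDeltaTheta_normal l).conj_mem _ (hf.1 _) _⟩ :
      D.lDeltaTheta l) = ⟨_, hm⟩ * ⟨(f.1 (C.inclYdduu b) : D.GtpTheta), hf.1 _⟩ := by
    apply Subtype.ext
    rw [Subgroup.coe_mul]
    exact C.conjRoot_pow_coe_eq hC h15 hf a ha m (C.inclYdduu b) hb
  rw [hsplit, map_mul, hred, inv_mul_cancel_right]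

/-- **Family form of the glue**: residue-form point-hearts at EVERY level ⇒ the `hex` input «`∀ M, ∃ m, red_M v =
red_M (conjRoot (a^m) f b̃)`» of `exists_compatible_exponents` (p493568). [cite: MochizukiEtTh2009, Cor 2.19(iii) p.65] -/
theorem forall_exists_exponent_value_of_residue (hC : D.Compat) (hS : D.Sec2Hyps) (h15 : Prop15iii E hC)
    {f : contCocycles D.toTheta D.DeltaTheta C.GtpYdduu} (hf : f ∈ C.rootCocycles hC)
    (a : C.Huu) (ha : D.aug.toMonoidHom (a : D.PiTemp) = 1)
    (b : (C.thetaEnvTower τ hC hS).PiYdd) (hb : D.aug.toMonoidHom ((b : C.Huu) : D.PiTemp) = 1)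
    (v : D.lDeltaTheta l)
    (hres : ∀ M : Es, ∃ (m : ℤ) (hm : D.toTheta ((((a ^ m : C.Huu) : D.PiTemp))⁻¹ * ((b : C.Huu) : D.PiTemp) *
        ((a ^ m : C.Huu) : D.PiTemp) * (((b : C.Huu) : D.PiTemp))⁻¹) ∈ D.lDeltaTheta l),
      (τ.mod M).red ⟨_, hm⟩ = (τ.mod M).red v * ((τ.mod M).red ⟨(f.1 (C.inclYdduu b) : D.GtpTheta), hf.1 _⟩)⁻¹) :
    ∀ M : Es, ∃ m : ℤ, (τ.mod M).red v =
      (τ.mod M).red ⟨(C.conjRoot hC (a ^ m) f.1 (C.inclYdduu b) : D.GtpTheta), (D.lDeltaTheta_normal l).conj_mem _ (hf.1 _) _⟩ :=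
  fun M => C.exists_exponent_value_of_residue τ hC hS h15 hf a ha b hb M v (hres M)

end ThetaSetting.EtaleThetaData.DoubleUnderline

end Literature.AnabelianGeometry.EtaleTheta

end
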